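import Summits.FinalStateConjecture.FinalStateConjecture.Theses.DissipativeFinalMotions
import Summits.FinalStateConjecture.FinalStateConjecture.Theorems.DissipativeFinalMotionsDispersingCaptureStubAsymptoticVelocity
import Summits.FinalStateConjecture.FinalStateConjecture.Theorems.DissipativeFinalMotionsDispersingCaptureStubCaptureNoHoles
import Summits.FinalStateConjecture.FinalStateConjecture.Theorems.DissipativeFinalMotionsDispersingCaptureStubSeparation
import Summits.FinalStateConjecture.FinalStateConjecture.Theorems.DissipativeFinalMotionsDispersingCaptureStubBoostTransport
import Summits.FinalStateConjecture.FinalStateConjecture.Theorems.DissipativeFinalMotionsDispersingCaptureStubOrientedAssembly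
import Summits.FinalStateConjecture.FinalStateConjecture.Theorems.DissipativeFinalMotionsDispersingCaptureStubCaptureOfSettled
import Summits.FinalStateConjecture.FinalStateConjecture.Theorems.DissipativeFinalMotionsDispersingCaptureStubCaptureOfSettledOn
import Literature.Geometry.Lorentzian.FinalEraRestFrameSettling
import HarnessLib

/-!
# Birth skeleton r12 — crux stmt-FinalStateConjecture-17643 `Theses.DissipativeFinalMotions.DispersingCapture` (rank 3)
# line `birth` (payload slug `registered`); leads c2 (r4/r5), c3 (r6–r9), c6 (r10), 2026-08-17

The crux (rev 3): for admissible data, an MGHD with complete `𝓘⁺`, and a rev-2 final era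
`IsFinalEra₂ N M a T δ V C₁ C₂ ρ₀ κ ξ β U₀ B₀ B Ψ₀ Ψ O` (31 clauses) with (R) `RaysStayInClosure 𝒟 O`,
(F) eventual future-orientation of the rest-frame hole charts and (F₀) of the far flat chart: IF the
labels pairwise disperse (`‖ξᵢ − ξⱼ‖ → ∞`) THEN the re-typed Statement's conclusion holds for `𝒟`
(`∃ O' d`, sub-extremal, `O' = exteriorOf 𝒟 d.charted`, `RaysStayInClosure`, `HasExhaustiveCharts`,
`IsFutureOriented`).

History r1–r9: see the r9 header in the crux dir (`Lines/birth.lean` @ r9) and `Lines/birth*.md`,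
`Lines/registered-dead*.md`. FINAL SHAPE r9: `DispersingCapture_of : E → B₁ → DispersingCapture` with A
p145569, B₀ p146009, B_sep p149503, B₂a p149957, B₂b p149167, C p154603, C′ p155631 landed and the
Literature predicate `IsRestFrameSettledOn` p154854; B₁ `stub_restFrameSettledData` (rest-frame
Statement-shaped settled data) found NOT DERIVABLE by five leads (c1–c5): its exhaustion clause (S6) fails
to follow from the package at band/collar points where the two chart clocks disagree.

RESHAPE r10 (lead c6, this file). The sixth audit (`Lines/registered-dead-c6.md` §2) locates the whole
gap in TWO primitive chart normalisations and shows that, granted them, B₁ IS derivable from the package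
by `J⁻`-monotonicity of (EX) at the same level plus ONE certified causal leg (a hover at constant
Kerr–Schild radius `≥ 100 Mᵢ` under `C⁰`-deviation `≤ 1/20`, for which the tree's cone algebra of
`Literature.Geometry.Lorentzian.BoostedKerrCausalLegs` applies). B₁ is therefore CUT at a finer seam:

* B₁ₐ `stub_normalisedOverlap` — crux hypotheses ⇒ (NDF) no deep flat points (a point charted by the flat
  chart and by hole chart `i` at hole time `> T` has radius `≥ 100 Mᵢ`) and (NL) no hole-clock lead on
  bounded zones (for every `R'`, eventually in hole time, a doubly charted point of hole radius `≤ R'` has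
  hole time `≤` flat time). THE RESIDUAL RESTATEMENT TARGET: not derivable (c4's family violates (NL),
  c5's conveyor / c1–c2's collar points violate (NDF)); honest for the intended eras (normalisations). It is
  what a rev-4 package must carry under option C (`Cruxes/DispersingCapture/OptionC_c6.lean`).
* H_rad `stub_honestRadii` — package + dispersal ⇒ quantitative effacement at every fixed radius and honest
  growing radii `Rᵢ → ∞`, `Rᵢ ≥ max(r₊,0)+1`, `Rᵢ ≥ 2ρ₀`, with `truncDeviationCk … (Rᵢ τ) τ → 0`
  (diagonal lemma `exists_diagonal_radius`). Size M.
* H_hov `stub_hoverLeg` — the certified leg: for a smooth chart `Ψ` of `Kerr.background M a`, a domain point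
  `x` of radius `≥ 100 M`, and `s > 0`, if `‖Ψ^*g − g_{M,a}‖ ≤ 1/20` along the coordinate segment
  `x + [0,s]e₀` and `dΨ(V)` (`V = Kerr.timeVector`) is future-directed at `x`, then `Ψ x ∈ J⁻{Ψ(x + s e₀)}`
  (`kerrBilin_ofTimeSpace_one_le`, `segment_mem_causalFuture`, `isFutureDirected_iff_val_neg`). Size M/L.
* H_thin `stub_thinnedFlatChart` — restriction/restart API: the flat chart restricted to `U₀ ⊓ W` is a late
  chart after any `T₁ ≥ T` with the same differential and the same derivatives of the extended deviation;
  any late chart restarts at a later time. Size M.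
* H_core `stub_settledOfNormalised` — the BRIDGE := package + (NDF) + (NL) + (F) + (F₀) + dispersal ⇒
  `∃ T₁ ρ R U₁ Φ₀, IsRestFrameSettledOn …` (proved FROM the landed H_rad, H_hov, H_thin): the step-thinned flat domain
  `U₁ = U₀ ⊓ ⋃ₘ {tₘ < t < tₘ₊₂, distᵢ > ρₘ}` with steps after the (F3)/(X3)/(X4b)/(H3)/(F)/(NL)/radius
  thresholds, `Φ₀ = Ψ₀|U₁`, and the case analysis of §2 for (O1)/(S6). Size XL (lead).

Composition `DispersingCapture_of : E → B₁ₐ → H_rad → H_hov → H_thin → H_core → DispersingCapture` (real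
proof; H_rad, H_hov, H_thin are consumed by H_core's landed proof, which imports them, and are threaded
here only so that the registered stub set is exactly the hypothesis list): `N = 0` is the landed B₀; for
`N = n + 1`, B₁ₐ gives (NDF)+(NL), H_core the settled data, C′ captures with E's rates.

r11 (lead c6, same day): H_rad p165018, H_hov p165236, H_thin p165199 LANDED (wave 1; Theorems/DissipativeFinalMotionsDispersingCaptureStub{HonestRadii,HoverLeg,ThinnedFlatChart}.lean —
not imported here, they are consumed by H_core's proof only); H_core's proof is cut
into three registered sub-stubs H_step `stub_stepData` (thresholds/levels; worker), H_zone `stub_zoneHover` (hover to a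
truncated slab; worker) and H_exh `stub_exhaustion` ((O1)+(S6); lead), with the core assembly (S1–S5, S7, C0, C1 + glue)
kernel-checked against them in the lead's scratch file. Composition `E → B₁ₐ → H_step → H_zone → H_exh → H_core → crux`.

r12: H_step p166822, H_zone p166675, H_exh p166472 LANDED (wave 2 + lead). Composition `E → B₁ₐ → H_core → crux`; H_core (the
bridge, assembled from the five landed pieces in `Theorems/…StubSettledOfNormalised.lean`) is the last derivable stub.

Disproof.lean: none exists for this crux; negatives index: nothing for this decl (checked 2026-08-17 14:3xZ).
-/

set_option linter.dupNamespace false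

noncomputable section

open scoped Manifold ContDiff Topology
open Filter Set Function MeasureTheory Literature.Geometry.Lorentzian

namespace Summit.FinalStateConjecture.FinalStateConjecture.Cruxes.DispersingCapture.Birth

open Summit.FinalStateConjecture.FinalStateConjecture.Theses.DissipativeFinalMotions (DispersingCapture)
open Summit.FinalStateConjecture.FinalStateConjecture.Theorems.DissipativeFinalMotions.DispersingCapture
  (stub_asymptoticVelocity stub_captureNoHoles stub_separation stub_boostTransport stub_orientedAssembly
  stub_captureOfSettled stub_captureOfSettledOn)

/-! ## Legend: the stub statements as named propositions (verbatim the registered signatures) -/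

/-- Statement of `stub_escapeRate` (E): in an honest, oriented, dispersing final era of a vacuum MGHD
the pairwise escape rates `1/dᵢⱼ²` are integrable on `[T, ∞)`. -/
def Sig.stub_escapeRate : Prop :=
  open scoped Manifold Topology in ∀ (X : Type) [TopologicalSpace X] [ChartedSpace (EuclideanSpace ℝ (Fin 3)) X] [IsManifold (𝓡 3) ((⊤ : ℕ∞) : WithTop ℕ∞) X] [T2Space X] [SecondCountableTopology X] [ConnectedSpace X], ∀ (D : Literature.Geometry.Lorentzian.InitialDataSet (𝓡 3) X), D ∈ Literature.Geometry.Lorentzian.admissibleVacuumData X → ∀ (𝒟 : Literature.Geometry.Lorentzian.VacuumCauchyDevelopment D), 𝒟.IsMaximal → Summit.FinalStateConjecture.HasCompleteNullInfinity 𝒟.toCauchyDevelopment → ∀ (N : ℕ) (M a : Fin N → ℝ) (T δ V C₁ C₂ ρ₀ κ : ℝ) (ξ : Fin N → ℝ → EuclideanSpace ℝ (Fin 3)) (β : ℝ → ℝ) (U₀ : TopologicalSpace.Opens Literature.Geometry.Lorentzian.E4) (B₀ : Literature.Geometry.Lorentzian.ModelBackground) (B : Fin N → Literature.Geometry.Lorentzian.ModelBackground)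 (Ψ₀ : B₀.domain → 𝒟.carrier) (Ψ : (i : Fin N) → (B i).domain → 𝒟.carrier) (O : Set 𝒟.carrier), 𝒟.toCauchyDevelopment.IsFinalEra₂ N M a T δ V C₁ C₂ ρ₀ κ ξ β U₀ B₀ B Ψ₀ Ψ O → Summit.FinalStateConjecture.RaysStayInClosure 𝒟.toCauchyDevelopment O → (∀ i (ρ : ℝ), ∀ᶠ τ in Filter.atTop, ∀ x ∈ (B i).truncTimeSlab ρ τ, 𝒟.toSpacetime.timeOrientation.IsFutureDirected (mfderiv 𝓘(ℝ, Literature.Geometry.Lorentzian.E4) (𝓡 4) (Ψ i) x (Literature.Geometry.Lorentzian.Kerr.timeVector (M i) (a i) x.1))) → (∃ ϱ₀ : ℝ, ∀ᶠ τ in Filter.atTop, ∀ x ∈ B₀.timeSlab τ, (∀ i, ϱ₀ ≤ ‖Literature.Geometry.Lorentzian.E4.spatial x.1 - ξ i τ‖) → 𝒟.toSpacetime.timeOrientation.IsFutureDirected (mfderiv 𝓘(ℝ, Literature.Geometry.Lorentzian.E4) (𝓡 4) Ψ₀ x (Literature.Geometry.Lorentzian.E4.basisVector 0))) → (∀ i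 j, i ≠ j → Filter.Tendsto (fun t ↦ ‖ξ i t - ξ j t‖) Filter.atTop Filter.atTop) → ∀ i j, i ≠ j → MeasureTheory.IntegrableOn (fun t ↦ 1 / ‖ξ i t - ξ j t‖ ^ 2) (Set.Ici T)

/-- Statement of `stub_normalisedOverlap` (B₁ₐ): crux hypotheses ⇒ the two chart normalisations (NDF) no
deep flat points, (NL) no hole-clock lead on bounded zones. THE RESIDUAL RESTATEMENT TARGET. -/
def Sig.stub_normalisedOverlap : Prop :=
  open scoped Manifold Topology in ∀ (X : Type) [TopologicalSpace X] [ChartedSpace (EuclideanSpace ℝ (Fin 3)) X] [IsManifold (𝓡 3) ((⊤ : ℕ∞) : WithTop ℕ∞) X] [T2Space X] [SecondCountableTopology X] [ConnectedSpace X], ∀ (D : Literature.Geometry.Lorentzian.InitialDataSet (𝓡 3) X), D ∈ Literature.Geometry.Lorentzian.admissibleVacuumData X → ∀ (𝒟 : Literature.Geometry.Lorentzian.VacuumCauchyDevelopment D), 𝒟.IsMaximal → Summit.FinalStateConjecture.HasCompleteNullInfinity 𝒟.toCauchyDevelopment → ∀ (N : ℕ) (M a : Fin N → ℝ) (T δ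 V C₁ C₂ ρ₀ κ : ℝ) (ξ : Fin N → ℝ → EuclideanSpace ℝ (Fin 3)) (β : ℝ → ℝ) (U₀ : TopologicalSpace.Opens Literature.Geometry.Lorentzian.E4) (B₀ : Literature.Geometry.Lorentzian.ModelBackground) (B : Fin N → Literature.Geometry.Lorentzian.ModelBackground) (Ψ₀ : B₀.domain → 𝒟.carrier) (Ψ : (i : Fin N) → (B i).domain → 𝒟.carrier) (O : Set 𝒟.carrier), 𝒟.toCauchyDevelopment.IsFinalEra₂ N M a T δ V C₁ C₂ ρ₀ κ ξ β U₀ B₀ B Ψ₀ Ψ O → Summit.FinalStateConjecture.RaysStayInClosure 𝒟.toCauchyDevelopment O → (∀ i (ρ : ℝ), ∀ᶠ τ in Filter.atTop, ∀ x ∈ (B i).truncTimeSlab ρ τ, 𝒟.toSpacetime.timeOrientation.IsFutureDirected (mfderiv 𝓘(ℝ, Literature.Geometry.Lorentzian.E4) (𝓡 4) (Ψ i) x (Literature.Geometry.Lorentzian.Kerr.timeVector (M i) (a i) x.1))) → (∃ ϱ₀ : ℝ, ∀ᶠ τ in Filter.atTop, ∀ x ∈ B₀.timeSlab τ, (∀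 i, ϱ₀ ≤ ‖Literature.Geometry.Lorentzian.E4.spatial x.1 - ξ i τ‖) → 𝒟.toSpacetime.timeOrientation.IsFutureDirected (mfderiv 𝓘(ℝ, Literature.Geometry.Lorentzian.E4) (𝓡 4) Ψ₀ x (Literature.Geometry.Lorentzian.E4.basisVector 0))) → (∀ i j, i ≠ j → Filter.Tendsto (fun t ↦ ‖ξ i t - ξ j t‖) Filter.atTop Filter.atTop) →
    (∀ i (x : (B i).domain) (y : B₀.domain), T < x.1 0 → Ψ i x = Ψ₀ y → 100 * M i ≤ (B i).radius x.1) ∧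
    (∀ i (R' : ℝ), ∃ T₄ : ℝ, ∀ (x : (B i).domain) (y : B₀.domain), T₄ ≤ x.1 0 → (B i).radius x.1 ≤ R' → Ψ i x = Ψ₀ y → x.1 0 ≤ y.1 0)

/-- Statement of `stub_honestRadii` (H_rad): package + dispersal ⇒ quantitative effacement at every fixed
radius, and honest growing radii with convergence out to them. -/
def Sig.stub_honestRadii : Prop :=
  open scoped Manifold Topology in ∀ (X : Type) [TopologicalSpace X] [ChartedSpace (EuclideanSpace ℝ (Fin 3)) X] [IsManifold (𝓡 3) ((⊤ : ℕ∞) : WithTop ℕ∞) X] [T2Space X] [SecondCountableTopology X] [ConnectedSpace X], ∀ (D : Literature.Geometry.Lorentzian.InitialDataSet (𝓡 3) X) (𝒟 : Literature.Geometry.Lorentzian.VacuumCauchyDevelopment D) (N : ℕ) (M a : Fin N → ℝ) (T δ V C₁ C₂ ρ₀ κ : ℝ) (ξ : Fin N → ℝ → EuclideanSpace ℝ (Fin 3)) (β : ℝ → ℝ) (U₀ : TopologicalSpace.Opens Literature.Geometry.Lorentzian.E4) (B₀ : Literature.Geometry.Lorentzian.ModelBackground) (B : Fin N → Literature.Geometry.Lorentzian.ModelBackground)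 (Ψ₀ : B₀.domain → 𝒟.carrier) (Ψ : (i : Fin N) → (B i).domain → 𝒟.carrier) (O : Set 𝒟.carrier), 𝒟.toCauchyDevelopment.IsFinalEra₂ N M a T δ V C₁ C₂ ρ₀ κ ξ β U₀ B₀ B Ψ₀ Ψ O → (∀ i j, i ≠ j → Filter.Tendsto (fun t ↦ ‖ξ i t - ξ j t‖) Filter.atTop Filter.atTop) →
    (∀ i (L ε : ℝ), 0 < ε → ∃ T'' : ℝ, ∀ τ, T'' ≤ τ → 𝒟.toSpacetime.truncDeviationCk (B i) (Ψ i) 2 L τ ≤ ENNReal.ofReal ε) ∧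
    ∃ R : Fin N → ℝ → ℝ, (∀ i, Filter.Tendsto (R i) Filter.atTop Filter.atTop ∧ ∀ τ, max (Literature.Geometry.Lorentzian.Kerr.rPlus (M i) (a i)) 0 + 1 ≤ R i τ) ∧ (∀ i τ, 2 * ρ₀ ≤ R i τ) ∧ (∀ i, Filter.Tendsto (fun τ ↦ 𝒟.toSpacetime.truncDeviationCk (B i) (Ψ i) 2 (R i τ) τ) Filter.atTop (nhds 0))

/-- Statement of `stub_hoverLeg` (H_hov): the certified hover leg at constant Kerr–Schild radius
`≥ 100 M` under `C⁰`-deviation `≤ 1/20`, started future-directed by (F). -/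
def Sig.stub_hoverLeg : Prop :=
  open scoped Manifold Topology in ∀ (X : Type) [TopologicalSpace X] [ChartedSpace (EuclideanSpace ℝ (Fin 3)) X] [IsManifold (𝓡 3) ((⊤ : ℕ∞) : WithTop ℕ∞) X] [T2Space X] [SecondCountableTopology X] [ConnectedSpace X], ∀ (D : Literature.Geometry.Lorentzian.InitialDataSet (𝓡 3) X) (𝒟 : Literature.Geometry.Lorentzian.VacuumCauchyDevelopment D) (M a : ℝ) (Ψ : (Literature.Geometry.Lorentzian.Kerr.background M a).domain → 𝒟.carrier) (x : (Literature.Geometry.Lorentzian.Kerr.background M a).domain) (s : ℝ), 0 ≤ M → 0 < s → ContMDiff 𝓘(ℝ, Literature.Geometry.Lorentzian.E4) (𝓡 4) ((⊤ : ℕ∞) : WithTop ℕ∞) Ψ → 100 * M ≤ Literature.Geometry.Lorentzian.Kerr.radius a x.1 → (∀ z : (Literature.Geometry.Lorentzian.Kerr.background M a).domain, x.1 0 ≤ z.1 0 → z.1 0 ≤ x.1 0 + s → Literature.Geometry.Lorentzian.E4.spatial z.1 = Literature.Geometry.Lorentzian.E4.spatial x.1 → ‖𝒟.toSpacetime.deviation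 (Literature.Geometry.Lorentzian.Kerr.background M a) Ψ z‖ ≤ 1 / 20) → 𝒟.toSpacetime.timeOrientation.IsFutureDirected (mfderiv 𝓘(ℝ, Literature.Geometry.Lorentzian.E4) (𝓡 4) Ψ x (Literature.Geometry.Lorentzian.Kerr.timeVector M a x.1)) →
    ∃ z : (Literature.Geometry.Lorentzian.Kerr.background M a).domain, z.1 = x.1 + s • Literature.Geometry.Lorentzian.E4.basisVector 0 ∧ Ψ x ∈ 𝒟.toSpacetime.metric.causalPast 𝒟.toSpacetime.timeOrientation {Ψ z}

/-- Statement of `stub_thinnedFlatChart` (H_thin): restriction of the flat chart to `U₀ ⊓ W` (late chart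
after any `T₁ ≥ T`, same differential, same derivatives of the extended deviation) and restart of any late
chart at a later time. -/
def Sig.stub_thinnedFlatChart : Prop :=
  open scoped Manifold Topology in ∀ (X : Type) [TopologicalSpace X] [ChartedSpace (EuclideanSpace ℝ (Fin 3)) X] [IsManifold (𝓡 3) ((⊤ : ℕ∞) : WithTop ℕ∞) X] [T2Space X] [SecondCountableTopology X] [ConnectedSpace X], ∀ (D : Literature.Geometry.Lorentzian.InitialDataSet (𝓡 3) X) (𝒟 : Literature.Geometry.Lorentzian.VacuumCauchyDevelopment D) (O : Set 𝒟.carrier) (T T₁ : ℝ), T ≤ T₁ →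
    (∀ (B' : Literature.Geometry.Lorentzian.ModelBackground) (Ψ' : B'.domain → 𝒟.carrier), Continuous B'.time → 𝒟.toSpacetime.IsLateChart B' O T Ψ' → 𝒟.toSpacetime.IsLateChart B' O T₁ Ψ') ∧
    ∀ (U₀ W : TopologicalSpace.Opens Literature.Geometry.Lorentzian.E4) (Ψ₀ : (Literature.Geometry.Lorentzian.Minkowski.backgroundOn U₀).domain → 𝒟.carrier), 𝒟.toSpacetime.IsLateChart (Literature.Geometry.Lorentzian.Minkowski.backgroundOn U₀) O T Ψ₀ →
      ∃ Φ₀ : (Literature.Geometry.Lorentzian.Minkowski.backgroundOn (U₀ ⊓ W)).domain → 𝒟.carrier,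
        (∀ y : (Literature.Geometry.Lorentzian.Minkowski.backgroundOn (U₀ ⊓ W)).domain, Φ₀ y = Ψ₀ ⟨y.1, y.2.1⟩) ∧
        𝒟.toSpacetime.IsLateChart (Literature.Geometry.Lorentzian.Minkowski.backgroundOn (U₀ ⊓ W)) O T₁ Φ₀ ∧
        (∀ (y : (Literature.Geometry.Lorentzian.Minkowski.backgroundOn (U₀ ⊓ W)).domain) (v : Literature.Geometry.Lorentzian.E4), mfderiv 𝓘(ℝ, Literature.Geometry.Lorentzian.E4) (𝓡 4) Φ₀ y v = mfderiv 𝓘(ℝ, Literature.Geometry.Lorentzian.E4) (𝓡 4) Ψ₀ ⟨y.1, y.2.1⟩ v) ∧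
        (∀ (m : ℕ) (y : (Literature.Geometry.Lorentzian.Minkowski.backgroundOn (U₀ ⊓ W)).domain), iteratedFDeriv ℝ m (𝒟.toSpacetime.deviationExtend (Literature.Geometry.Lorentzian.Minkowski.backgroundOn (U₀ ⊓ W)) Φ₀) y.1 = iteratedFDeriv ℝ m (𝒟.toSpacetime.deviationExtend (Literature.Geometry.Lorentzian.Minkowski.backgroundOn U₀) Ψ₀) y.1)

/-- Statement of `stub_stepData` (H_step; r11). -/
def Sig.stub_stepData : Prop :=
  open scoped Manifold Topology in ∀ (X : Type) [TopologicalSpace X] [ChartedSpace (EuclideanSpace ℝ (Fin 3)) X] [IsManifold (𝓡 3) ((⊤ : ℕ∞) : WithTop ℕ∞) X] [T2Space X] [SecondCountableTopology X] [ConnectedSpace X], ∀ (D : Literature.Geometry.Lorentzian.InitialDataSet (𝓡 3) X) (𝒟 : Literature.Geometry.Lorentzian.VacuumCauchyDevelopment D) (N : ℕ) (M a : Fin N → ℝ) (T C₁ C₂ ρ₀ ϱ₀ : ℝ) (ξ : Fin N → ℝ → EuclideanSpace ℝ (Fin 3)) (U₀ : TopologicalSpace.Opens Literature.Geometry.Lorentzian.E4)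 (Ψ₀ : (Literature.Geometry.Lorentzian.Minkowski.backgroundOn U₀).domain → 𝒟.carrier) (Ψ : (i : Fin N) → (Literature.Geometry.Lorentzian.Kerr.background (M i) (a i)).domain → 𝒟.carrier) (R : Fin N → ℝ → ℝ),
    (∀ ε : ℝ, 0 < ε → ∃ ϱ T' : ℝ, ∀ τ, T' ≤ τ → Literature.Geometry.Lorentzian.supCkENorm (Subtype.val '' {y : (Literature.Geometry.Lorentzian.Minkowski.backgroundOn U₀).domain | y.1 0 = τ ∧ ∀ i, ϱ ≤ ‖Literature.Geometry.Lorentzian.E4.spatial y.1 - ξ i τ‖}) 2 (𝒟.toSpacetime.deviationExtend (Literature.Geometry.Lorentzian.Minkowski.backgroundOn U₀) Ψ₀) ≤ ENNReal.ofReal ε) →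
    (∀ᶠ τ in Filter.atTop, ∀ y ∈ (Literature.Geometry.Lorentzian.Minkowski.backgroundOn U₀).timeSlab τ, (∀ i, ϱ₀ ≤ ‖Literature.Geometry.Lorentzian.E4.spatial y.1 - ξ i τ‖) → 𝒟.toSpacetime.timeOrientation.IsFutureDirected (mfderiv 𝓘(ℝ, Literature.Geometry.Lorentzian.E4) (𝓡 4) Ψ₀ y (Literature.Geometry.Lorentzian.E4.basisVector 0))) →
    (∀ i (R' : ℝ), ∃ T₃ : ℝ, ∀ y : (Literature.Geometry.Lorentzian.Minkowski.backgroundOn U₀).domain, T₃ < y.1 0 → ‖Literature.Geometry.Lorentzian.E4.spatial y.1 - ξ i (y.1 0)‖ ≤ R' → ∃ x : (Literature.Geometry.Lorentzian.Kerr.background (M i) (a i)).domain, Ψ i x = Ψ₀ y ∧ T < x.1 0 ∧ Literature.Geometry.Lorentzian.Kerr.radius (a i) x.1 ≤ C₂ * R' + C₁) →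
    (∀ i (τ' R' : ℝ), ∃ t₀ : ℝ, Ψ₀ '' {y : (Literature.Geometry.Lorentzian.Minkowski.backgroundOn U₀).domain | t₀ < y.1 0} ∩ Ψ i '' {x : (Literature.Geometry.Lorentzian.Kerr.background (M i) (a i)).domain | x.1 0 ≤ τ' ∧ Literature.Geometry.Lorentzian.Kerr.radius (a i) x.1 ≤ R'} = ∅) →
    (∀ i (L ε : ℝ), 0 < ε → ∃ T'' : ℝ, ∀ τ, T'' ≤ τ → 𝒟.toSpacetime.truncDeviationCk (Literature.Geometry.Lorentzian.Kerr.background (M i) (a i)) (Ψ i) 2 L τ ≤ ENNReal.ofReal ε) →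
    (∀ i (ρ : ℝ), ∀ᶠ τ in Filter.atTop, ∀ x ∈ (Literature.Geometry.Lorentzian.Kerr.background (M i) (a i)).truncTimeSlab ρ τ, 𝒟.toSpacetime.timeOrientation.IsFutureDirected (mfderiv 𝓘(ℝ, Literature.Geometry.Lorentzian.E4) (𝓡 4) (Ψ i) x (Literature.Geometry.Lorentzian.Kerr.timeVector (M i) (a i) x.1))) →
    (∀ i (R' : ℝ), ∃ T₄ : ℝ, ∀ (x : (Literature.Geometry.Lorentzian.Kerr.background (M i) (a i)).domain) (y : (Literature.Geometry.Lorentzian.Minkowski.backgroundOn U₀).domain), T₄ ≤ x.1 0 → Literature.Geometry.Lorentzian.Kerr.radius (a i) x.1 ≤ R' → Ψ i x = Ψ₀ y → x.1 0 ≤ y.1 0) →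
    (∀ i, Filter.Tendsto (R i) Filter.atTop Filter.atTop) →
    ∃ (t : ℕ → ℝ) (ρl : ℕ → ℝ) (τ' : ℕ → ℝ),
      StrictMono t ∧ (∀ m : ℕ, (m : ℝ) ≤ t m) ∧ (∀ m : ℕ, |T| + 1 ≤ t m) ∧
      Monotone ρl ∧ (∀ m : ℕ, ρ₀ ≤ ρl m) ∧ (∀ m : ℕ, (m : ℝ) + 1 ≤ ρl m) ∧ (∀ m : ℕ, ((m : ℝ) + 1) * ρl m ≤ t m) ∧
      (∀ (m : ℕ) (τ : ℝ), t m ≤ τ → Literature.Geometry.Lorentzian.supCkENorm (Subtype.val '' {y : (Literature.Geometry.Lorentzian.Minkowski.backgroundOn U₀).domain | y.1 0 = τ ∧ ∀ i, ρl m ≤ ‖Literature.Geometry.Lorentzian.E4.spatial y.1 - ξ i τ‖}) 2 (𝒟.toSpacetime.deviationExtend (Literature.Geometry.Lorentzian.Minkowski.backgroundOn U₀) Ψ₀) ≤ ENNReal.ofReal (1 / ((m : ℝ) + 1))) ∧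
      (∀ m τ, t m ≤ τ → ∀ y ∈ (Literature.Geometry.Lorentzian.Minkowski.backgroundOn U₀).timeSlab τ, (∀ i, ρl m ≤ ‖Literature.Geometry.Lorentzian.E4.spatial y.1 - ξ i τ‖) → 𝒟.toSpacetime.timeOrientation.IsFutureDirected (mfderiv 𝓘(ℝ, Literature.Geometry.Lorentzian.E4) (𝓡 4) Ψ₀ y (Literature.Geometry.Lorentzian.E4.basisVector 0))) ∧
      (∀ m i (y : (Literature.Geometry.Lorentzian.Minkowski.backgroundOn U₀).domain), t m < y.1 0 → ‖Literature.Geometry.Lorentzian.E4.spatial y.1 - ξ i (y.1 0)‖ ≤ ρl m → ∃ x : (Literature.Geometry.Lorentzian.Kerr.background (M i) (a i)).domain, Ψ i x = Ψ₀ y ∧ τ' m < x.1 0 ∧ Literature.Geometry.Lorentzian.Kerr.radius (a i) x.1 ≤ C₂ * ρl m + C₁) ∧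
      (∀ m : ℕ, T ≤ τ' m) ∧
      (∀ m i τ, τ' m ≤ τ → 𝒟.toSpacetime.truncDeviationCk (Literature.Geometry.Lorentzian.Kerr.background (M i) (a i)) (Ψ i) 2 (C₂ * ρl m + C₁) τ ≤ ENNReal.ofReal (1 / 20)) ∧
      (∀ m i τ, τ' m ≤ τ → ∀ x ∈ (Literature.Geometry.Lorentzian.Kerr.background (M i) (a i)).truncTimeSlab (C₂ * ρl m + C₁) τ, 𝒟.toSpacetime.timeOrientation.IsFutureDirected (mfderiv 𝓘(ℝ, Literature.Geometry.Lorentzian.E4) (𝓡 4) (Ψ i) x (Literature.Geometry.Lorentzian.Kerr.timeVector (M i) (a i) x.1))) ∧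
      (∀ m i (x : (Literature.Geometry.Lorentzian.Kerr.background (M i) (a i)).domain) (y : (Literature.Geometry.Lorentzian.Minkowski.backgroundOn U₀).domain), τ' m ≤ x.1 0 → Literature.Geometry.Lorentzian.Kerr.radius (a i) x.1 ≤ C₂ * ρl m + C₁ → Ψ i x = Ψ₀ y → x.1 0 ≤ y.1 0) ∧
      (∀ m i τ, τ' m ≤ τ → C₂ * ρl m + C₁ ≤ R i τ)

/-- Statement of `stub_zoneHover` (H_zone; r11). -/
def Sig.stub_zoneHover : Prop :=
  open scoped Manifold Topology in ∀ (X : Type) [TopologicalSpace X] [ChartedSpace (EuclideanSpace ℝ (Fin 3)) X] [IsManifold (𝓡 3) ((⊤ : ℕ∞) : WithTop ℕ∞) X] [T2Space X] [SecondCountableTopology X] [ConnectedSpace X], ∀ (D : Literature.Geometry.Lorentzian.InitialDataSet (𝓡 3) X) (𝒟 : Literature.Geometry.Lorentzian.VacuumCauchyDevelopment D) (M a : ℝ) (Ψ : (Literature.Geometry.Lorentzian.Kerr.background M a).domain → 𝒟.carrier) (x : (Literature.Geometry.Lorentzian.Kerr.background M a).domain) (L R' τ₀ τ₁ : ℝ),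 0 ≤ M → ContMDiff 𝓘(ℝ, Literature.Geometry.Lorentzian.E4) (𝓡 4) ((⊤ : ℕ∞) : WithTop ℕ∞) Ψ → 100 * M ≤ Literature.Geometry.Lorentzian.Kerr.radius a x.1 → Literature.Geometry.Lorentzian.Kerr.radius a x.1 ≤ L → L ≤ R' → τ₀ ≤ x.1 0 → x.1 0 ≤ τ₁ → (∀ τ, τ₀ ≤ τ → 𝒟.toSpacetime.truncDeviationCk (Literature.Geometry.Lorentzian.Kerr.background M a) Ψ 2 L τ ≤ ENNReal.ofReal (1 / 20)) → 𝒟.toSpacetime.timeOrientation.IsFutureDirected (mfderiv 𝓘(ℝ, Literature.Geometry.Lorentzian.E4) (𝓡 4) Ψ x (Literature.Geometry.Lorentzian.Kerr.timeVector M a x.1)) →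
    Ψ x ∈ 𝒟.toSpacetime.metric.causalPast 𝒟.toSpacetime.timeOrientation (Ψ '' (Literature.Geometry.Lorentzian.Kerr.background M a).truncTimeSlab R' τ₁)

/-- Statement of `stub_exhaustion` (H_exh; r11). -/
def Sig.stub_exhaustion : Prop :=
  open scoped Manifold Topology in ∀ (X : Type) [TopologicalSpace X] [ChartedSpace (EuclideanSpace ℝ (Fin 3)) X] [IsManifold (𝓡 3) ((⊤ : ℕ∞) : WithTop ℕ∞) X] [T2Space X] [SecondCountableTopology X] [ConnectedSpace X], ∀ (D : Literature.Geometry.Lorentzian.InitialDataSet (𝓡 3) X) (𝒟 : Literature.Geometry.Lorentzian.VacuumCauchyDevelopment D) (N : ℕ) (M a : Fin N → ℝ) (T C₁ C₂ ρ₀ : ℝ) (ξ : Fin N → ℝ → EuclideanSpace ℝ (Fin 3)) (U₀ W : TopologicalSpace.Opens Literature.Geometry.Lorentzian.E4) (Ψ₀ : (Literature.Geometry.Lorentzian.Minkowski.backgroundOn U₀).domain → 𝒟.carrier) (Ψ : (i : Fin N) → (Literature.Geometry.Lorentzian.Kerr.background (M i) (a i)).domain → 𝒟.carrier) (O : Set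 𝒟.carrier) (R : Fin N → ℝ → ℝ) (t ρl τ' : ℕ → ℝ) (Φ₀ : (Literature.Geometry.Lorentzian.Minkowski.backgroundOn (U₀ ⊓ W)).domain → 𝒟.carrier),
    O = 𝒟.metric.causalFuture 𝒟.timeOrientation (Set.range 𝒟.embed) ∩ 𝒟.metric.chronologicalPast 𝒟.timeOrientation (Ψ₀ '' (Literature.Geometry.Lorentzian.Minkowski.backgroundOn U₀).lateRegion T ∪ ⋃ i, Ψ i '' (Literature.Geometry.Lorentzian.Kerr.background (M i) (a i)).lateRegion T) →
    𝒟.toSpacetime.IsLateChart (Literature.Geometry.Lorentzian.Minkowski.backgroundOn U₀) O T Ψ₀ →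
    (∀ i, 𝒟.toSpacetime.IsLateChart (Literature.Geometry.Lorentzian.Kerr.background (M i) (a i)) O T (Ψ i)) →
    (∀ τ₁, T < τ₁ → O \ (Ψ₀ '' (Literature.Geometry.Lorentzian.Minkowski.backgroundOn U₀).lateRegion τ₁ ∪ ⋃ i, Ψ i '' (Literature.Geometry.Lorentzian.Kerr.background (M i) (a i)).truncLateRegion τ₁ (2 * ρ₀)) ⊆ 𝒟.toSpacetime.metric.causalPast 𝒟.toSpacetime.timeOrientation (Ψ₀ '' (Literature.Geometry.Lorentzian.Minkowski.backgroundOn U₀).timeSlab τ₁ ∪ ⋃ i, Ψ i '' (Literature.Geometry.Lorentzian.Kerr.background (M i) (a i)).truncTimeSlab (2 * ρ₀) τ₁)) →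
    (∀ i τ, 2 * ρ₀ ≤ R i τ) →
    StrictMono t → (∀ m : ℕ, (m : ℝ) ≤ t m) → (∀ m : ℕ, T < t m) → (∀ m : ℕ, T ≤ τ' m) →
    (∀ m i (y : (Literature.Geometry.Lorentzian.Minkowski.backgroundOn U₀).domain), t m < y.1 0 → ‖Literature.Geometry.Lorentzian.E4.spatial y.1 - ξ i (y.1 0)‖ ≤ ρl m → ∃ x : (Literature.Geometry.Lorentzian.Kerr.background (M i) (a i)).domain, Ψ i x = Ψ₀ y ∧ τ' m < x.1 0 ∧ Literature.Geometry.Lorentzian.Kerr.radius (a i) x.1 ≤ C₂ * ρl m + C₁) →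
    (∀ m i (x : (Literature.Geometry.Lorentzian.Kerr.background (M i) (a i)).domain) (y : (Literature.Geometry.Lorentzian.Minkowski.backgroundOn U₀).domain), τ' m ≤ x.1 0 → Literature.Geometry.Lorentzian.Kerr.radius (a i) x.1 ≤ C₂ * ρl m + C₁ → Ψ i x = Ψ₀ y → x.1 0 ≤ y.1 0) →
    (∀ m i τ, τ' m ≤ τ → C₂ * ρl m + C₁ ≤ R i τ) →
    (∀ i (x : (Literature.Geometry.Lorentzian.Kerr.background (M i) (a i)).domain) (y : (Literature.Geometry.Lorentzian.Minkowski.backgroundOn U₀).domain), T < x.1 0 → Ψ i x = Ψ₀ y → 100 * M i ≤ Literature.Geometry.Lorentzian.Kerr.radius (a i) x.1) →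
    (∀ m i (x : (Literature.Geometry.Lorentzian.Kerr.background (M i) (a i)).domain) (τ₁ : ℝ), τ' m < x.1 0 → x.1 0 ≤ τ₁ → 100 * M i ≤ Literature.Geometry.Lorentzian.Kerr.radius (a i) x.1 → Literature.Geometry.Lorentzian.Kerr.radius (a i) x.1 ≤ C₂ * ρl m + C₁ → Ψ i x ∈ 𝒟.toSpacetime.metric.causalPast 𝒟.toSpacetime.timeOrientation (Ψ i '' (Literature.Geometry.Lorentzian.Kerr.background (M i) (a i)).truncTimeSlab (R i τ₁) τ₁)) →
    (∀ y : Literature.Geometry.Lorentzian.E4, y ∈ W → ∃ m : ℕ, t m < y 0 ∧ y 0 < t (m + 2) ∧ ∀ i, ρl m < ‖Literature.Geometry.Lorentzian.E4.spatial y - ξ i (y 0)‖) →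
    (∀ (y : Literature.Geometry.Lorentzian.E4) (m : ℕ), t m < y 0 → y 0 < t (m + 2) → (∀ i, ρl m < ‖Literature.Geometry.Lorentzian.E4.spatial y - ξ i (y 0)‖) → y ∈ W) →
    (∀ y : (Literature.Geometry.Lorentzian.Minkowski.backgroundOn (U₀ ⊓ W)).domain, Φ₀ y = Ψ₀ ⟨y.1, y.2.1⟩) →
    O = 𝒟.metric.causalFuture 𝒟.timeOrientation (Set.range 𝒟.embed) ∩ 𝒟.metric.chronologicalPast 𝒟.timeOrientation (Φ₀ '' (Literature.Geometry.Lorentzian.Minkowski.backgroundOn (U₀ ⊓ W)).lateRegion (t 0) ∪ ⋃ i, Ψ i '' (Literature.Geometry.Lorentzian.Kerr.background (M i) (a i)).lateRegion (t 0)) ∧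
    (∀ τ₁, t 0 < τ₁ → O \ (Φ₀ '' (Literature.Geometry.Lorentzian.Minkowski.backgroundOn (U₀ ⊓ W)).lateRegion τ₁ ∪ ⋃ i, Ψ i '' {x : (Literature.Geometry.Lorentzian.Kerr.background (M i) (a i)).domain | τ₁ < (Literature.Geometry.Lorentzian.Kerr.background (M i) (a i)).time x.1 ∧ (Literature.Geometry.Lorentzian.Kerr.background (M i) (a i)).radius x.1 ≤ R i ((Literature.Geometry.Lorentzian.Kerr.background (M i) (a i)).time x.1)}) ⊆ 𝒟.toSpacetime.metric.causalPast 𝒟.toSpacetime.timeOrientation (Φ₀ '' (Literature.Geometry.Lorentzian.Minkowski.backgroundOn (U₀ ⊓ W)).timeSlab τ₁ ∪ ⋃ i, Ψ i '' (Literature.Geometry.Lorentzian.Kerr.background (M i) (a i)).truncTimeSlab (R i τ₁) τ₁))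

/-- Statement of the BRIDGE (conclusion of `stub_settledOfNormalised`): a rev-2 final era satisfying
(NDF) and (NL), oriented ((F), (F₀)) and pairwise dispersing, settles in its own rest frames in the
Statement's shape, `∃ T₁ ρ R U₁ Φ₀, IsRestFrameSettledOn …` (Literature, p154854). -/
def Sig.stub_settledOfNormalised : Prop :=
  open scoped Manifold Topology in ∀ (X : Type) [TopologicalSpace X] [ChartedSpace (EuclideanSpace ℝ (Fin 3)) X] [IsManifold (𝓡 3) ((⊤ : ℕ∞) : WithTop ℕ∞) X] [T2Space X] [SecondCountableTopology X] [ConnectedSpace X], ∀ (D : Literature.Geometry.Lorentzian.InitialDataSet (𝓡 3) X) (𝒟 : Literature.Geometry.Lorentzian.VacuumCauchyDevelopment D) (N : ℕ) (M a : Fin N → ℝ) (T δ V C₁ C₂ ρ₀ κ : ℝ) (ξ : Fin N → ℝ → EuclideanSpace ℝ (Fin 3)) (β : ℝ → ℝ) (U₀ : TopologicalSpace.Opens Literature.Geometry.Lorentzian.E4) (B₀ : Literature.Geometry.Lorentzian.ModelBackground) (B : Fin N → Literature.Geometry.Lorentzian.ModelBackground) (Ψ₀ : B₀.domain → 𝒟.carrier)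 (Ψ : (i : Fin N) → (B i).domain → 𝒟.carrier) (O : Set 𝒟.carrier), 𝒟.toCauchyDevelopment.IsFinalEra₂ N M a T δ V C₁ C₂ ρ₀ κ ξ β U₀ B₀ B Ψ₀ Ψ O → (∀ i (x : (B i).domain) (y : B₀.domain), T < x.1 0 → Ψ i x = Ψ₀ y → 100 * M i ≤ (B i).radius x.1) → (∀ i (R' : ℝ), ∃ T₄ : ℝ, ∀ (x : (B i).domain) (y : B₀.domain), T₄ ≤ x.1 0 → (B i).radius x.1 ≤ R' → Ψ i x = Ψ₀ y → x.1 0 ≤ y.1 0) → (∀ i (ρ : ℝ), ∀ᶠ τ in Filter.atTop, ∀ x ∈ (B i).truncTimeSlab ρ τ, 𝒟.toSpacetime.timeOrientation.IsFutureDirected (mfderiv 𝓘(ℝ, Literature.Geometry.Lorentzian.E4) (𝓡 4) (Ψ i) x (Literature.Geometry.Lorentzian.Kerr.timeVector (M i) (a i) x.1))) → (∃ ϱ₀ : ℝ, ∀ᶠ τ in Filter.atTop, ∀ x ∈ B₀.timeSlab τ, (∀ i, ϱ₀ ≤ ‖Literature.Geometry.Lorentzian.E4.spatial x.1 - ξ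 i τ‖) → 𝒟.toSpacetime.timeOrientation.IsFutureDirected (mfderiv 𝓘(ℝ, Literature.Geometry.Lorentzian.E4) (𝓡 4) Ψ₀ x (Literature.Geometry.Lorentzian.E4.basisVector 0))) → (∀ i j, i ≠ j → Filter.Tendsto (fun t ↦ ‖ξ i t - ξ j t‖) Filter.atTop Filter.atTop) → ∃ (T₁ : ℝ) (ρ : ℝ → ℝ) (R : Fin N → ℝ → ℝ) (U₁ : TopologicalSpace.Opens Literature.Geometry.Lorentzian.E4) (Φ₀ : (Literature.Geometry.Lorentzian.Minkowski.backgroundOn U₁).domain → 𝒟.carrier), 𝒟.toCauchyDevelopment.IsRestFrameSettledOn N M a T₁ ξ B Ψ O U₁ Φ₀ ρ R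

/-! ## Registered stubs (`sorry` only here; signatures def-free and self-contained) -/

/-- **E — INTEGRABLE ESCAPE RATE OF A DISPERSING HONEST ERA** (the GR input of the line; unchanged
since r1). For admissible data, an MGHD with complete `𝓘⁺`, a rev-2 final era `IsFinalEra₂ …` with (R),
(F), (F₀), whose labels pairwise disperse: for `i ≠ j`, `t ↦ 1/‖ξᵢ(t) − ξⱼ(t)‖²` is integrable on
`[T, ∞)`. Expected from linear-momentum balance at `𝓘⁺` (Chazy–Marchal–Saari-like final motions,
`dᵢⱼ ≍ t` or `t^{2/3}`; Marchal–Saari 1976, Saari 1971). STATUS: `stub-blocked` (worker of lead c1):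
no in-tree theorem or Literature fact supplies the momentum balance for `N ≥ 2` holes (`EscapeRate₂`);
the kinematic spiral `d = √t`, `θ' = √(μ/d³)` satisfies (W1)–(W4) with `κ = 0`, `β ≈ t^{-5/4}/4 ∈ L¹`,
`∫ dt/d² = ∞`, so the package alone does not give it. Sources: MarchalSaari1976, doi:10.2307/1995609,
Blanchet2024, EinsteinInfeldHoffmann1938, arXiv:1310.1528, arXiv:2408.06715. Size: XL / open. -/
theorem stub_escapeRate : open scoped Manifold Topology in ∀ (X : Type) [TopologicalSpace X] [ChartedSpace (EuclideanSpace ℝ (Fin 3)) X] [IsManifold (𝓡 3) ((⊤ : ℕ∞) : WithTop ℕ∞) X] [T2Space X] [SecondCountableTopology X] [ConnectedSpace X], ∀ (D : Literature.Geometry.Lorentzian.InitialDataSet (𝓡 3) X), D ∈ Literature.Geometry.Lorentzian.admissibleVacuumData X → ∀ (𝒟 : Literature.Geometry.Lorentzian.VacuumCauchyDevelopment D), 𝒟.IsMaximal → Summit.FinalStateConjecture.HasCompleteNullInfinity 𝒟.toCauchyDevelopment → ∀ (N : ℕ) (M a : Fin N → ℝ) (T δ V C₁ C₂ ρ₀ κ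 : ℝ) (ξ : Fin N → ℝ → EuclideanSpace ℝ (Fin 3)) (β : ℝ → ℝ) (U₀ : TopologicalSpace.Opens Literature.Geometry.Lorentzian.E4) (B₀ : Literature.Geometry.Lorentzian.ModelBackground) (B : Fin N → Literature.Geometry.Lorentzian.ModelBackground) (Ψ₀ : B₀.domain → 𝒟.carrier) (Ψ : (i : Fin N) → (B i).domain → 𝒟.carrier) (O : Set 𝒟.carrier), 𝒟.toCauchyDevelopment.IsFinalEra₂ N M a T δ V C₁ C₂ ρ₀ κ ξ β U₀ B₀ B Ψ₀ Ψ O → Summit.FinalStateConjecture.RaysStayInClosure 𝒟.toCauchyDevelopment O → (∀ i (ρ : ℝ), ∀ᶠ τ in Filter.atTop, ∀ x ∈ (B i).truncTimeSlab ρ τ, 𝒟.toSpacetime.timeOrientation.IsFutureDirected (mfderiv 𝓘(ℝ, Literature.Geometry.Lorentzian.E4) (𝓡 4) (Ψ i) x (Literature.Geometry.Lorentzian.Kerr.timeVector (M i) (a i) x.1))) → (∃ ϱ₀ : ℝ, ∀ᶠ τ in Filter.atTop, ∀ x ∈ B₀.timeSlab τ, (∀ i, ϱ₀ ≤ ‖Literature.Geometry.Lorentzian.E4.spatial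 x.1 - ξ i τ‖) → 𝒟.toSpacetime.timeOrientation.IsFutureDirected (mfderiv 𝓘(ℝ, Literature.Geometry.Lorentzian.E4) (𝓡 4) Ψ₀ x (Literature.Geometry.Lorentzian.E4.basisVector 0))) → (∀ i j, i ≠ j → Filter.Tendsto (fun t ↦ ‖ξ i t - ξ j t‖) Filter.atTop Filter.atTop) → ∀ i j, i ≠ j → MeasureTheory.IntegrableOn (fun t ↦ 1 / ‖ξ i t - ξ j t‖ ^ 2) (Set.Ici T) := by
  sorry

/-- **B₁ₐ — NORMALISED CHART OVERLAP** (THE RESIDUAL RESTATEMENT TARGET of the line; r10). From the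
crux's hypotheses verbatim produce the two chart normalisations on the package's own charts: (NDF) a point
charted by `Ψ₀` and by `Ψᵢ` at hole time `> T` has Kerr–Schild radius `≥ 100 Mᵢ` (the radiation chart
never reaches the collar/ergoregion); (NL) for every radius `R'`, eventually in hole time, a doubly charted
point of hole radius `≤ R'` has hole time `≤` flat time (hole clocks never lead the radiation clock on
bounded zones). STATUS: NOT DERIVABLE by design — the package leaves both free (c4's lead family violates
(NL); deep flat fingers, legal under (F2)/(X2), violate (NDF)); this is exactly and only what a rev-4 package
must add under option C (`Cruxes/DispersingCapture/OptionC_c6.lean`), honest for the intended eras (flat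
domain `{dist > ρ₀}` with `ρ₀ ≥ 100 max Mᵢ + |aᵢ| + C₁`; boosted holes lead-free by `(γ−1)t*`, resting
holes after a `+1` shift of the hole clock). Sources: DafermosLuk2017 (Conj. 1), arXiv:2104.08222 §1.
Size: restatement. -/
theorem stub_normalisedOverlap : open scoped Manifold Topology in ∀ (X : Type) [TopologicalSpace X] [ChartedSpace (EuclideanSpace ℝ (Fin 3)) X] [IsManifold (𝓡 3) ((⊤ : ℕ∞) : WithTop ℕ∞) X] [T2Space X] [SecondCountableTopology X] [ConnectedSpace X], ∀ (D : Literature.Geometry.Lorentzian.InitialDataSet (𝓡 3) X), D ∈ Literature.Geometry.Lorentzian.admissibleVacuumData X → ∀ (𝒟 : Literature.Geometry.Lorentzian.VacuumCauchyDevelopment D), 𝒟.IsMaximal → Summit.FinalStateConjecture.HasCompleteNullInfinity 𝒟.toCauchyDevelopment → ∀ (N : ℕ) (M a : Fin N → ℝ) (T δ V C₁ C₂ ρ₀ κ : ℝ) (ξ : Fin N → ℝ → EuclideanSpace ℝ (Fin 3)) (β : ℝ → ℝ) (U₀ : TopologicalSpace.Opens Literature.Geometry.Lorentzian.E4) (B₀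 : Literature.Geometry.Lorentzian.ModelBackground) (B : Fin N → Literature.Geometry.Lorentzian.ModelBackground) (Ψ₀ : B₀.domain → 𝒟.carrier) (Ψ : (i : Fin N) → (B i).domain → 𝒟.carrier) (O : Set 𝒟.carrier), 𝒟.toCauchyDevelopment.IsFinalEra₂ N M a T δ V C₁ C₂ ρ₀ κ ξ β U₀ B₀ B Ψ₀ Ψ O → Summit.FinalStateConjecture.RaysStayInClosure 𝒟.toCauchyDevelopment O → (∀ i (ρ : ℝ), ∀ᶠ τ in Filter.atTop, ∀ x ∈ (B i).truncTimeSlab ρ τ, 𝒟.toSpacetime.timeOrientation.IsFutureDirected (mfderiv 𝓘(ℝ, Literature.Geometry.Lorentzian.E4) (𝓡 4) (Ψ i) x (Literature.Geometry.Lorentzian.Kerr.timeVector (M i) (a i) x.1))) → (∃ ϱ₀ : ℝ, ∀ᶠ τ in Filter.atTop, ∀ x ∈ B₀.timeSlab τ, (∀ i, ϱ₀ ≤ ‖Literature.Geometry.Lorentzian.E4.spatial x.1 - ξ i τ‖) → 𝒟.toSpacetime.timeOrientation.IsFutureDirected (mfderiv 𝓘(ℝ, Literature.Geometry.Lorentzian.E4)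 (𝓡 4) Ψ₀ x (Literature.Geometry.Lorentzian.E4.basisVector 0))) → (∀ i j, i ≠ j → Filter.Tendsto (fun t ↦ ‖ξ i t - ξ j t‖) Filter.atTop Filter.atTop) →
    (∀ i (x : (B i).domain) (y : B₀.domain), T < x.1 0 → Ψ i x = Ψ₀ y → 100 * M i ≤ (B i).radius x.1) ∧
    (∀ i (R' : ℝ), ∃ T₄ : ℝ, ∀ (x : (B i).domain) (y : B₀.domain), T₄ ≤ x.1 0 → (B i).radius x.1 ≤ R' → Ψ i x = Ψ₀ y → x.1 0 ≤ y.1 0) := by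
  sorry

-- stub_honestRadii: LANDED (statement recorded as `Sig.stub_honestRadii`; module Theorems/DissipativeFinalMotionsDispersingCapture… imported by H_core's proof).


-- stub_hoverLeg: LANDED (statement recorded as `Sig.stub_hoverLeg`; module Theorems/DissipativeFinalMotionsDispersingCapture… imported by H_core's proof).


-- stub_thinnedFlatChart: LANDED (statement recorded as `Sig.stub_thinnedFlatChart`; module Theorems/DissipativeFinalMotionsDispersingCapture… imported by H_core's proof).


-- stub_stepData: LANDED (statement recorded as `Sig.stub_stepData`; Theorems/DissipativeFinalMotionsDispersingCaptureStub… imported by H_core's proof).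


-- stub_zoneHover: LANDED (statement recorded as `Sig.stub_zoneHover`; Theorems/DissipativeFinalMotionsDispersingCaptureStub… imported by H_core's proof).


-- stub_exhaustion: LANDED (statement recorded as `Sig.stub_exhaustion`; Theorems/DissipativeFinalMotionsDispersingCaptureStub… imported by H_core's proof).


/-- **H_core — SETTLED DATA OF A NORMALISED ERA = THE BRIDGE** (the lead's stub; r10; its landed proof
imports the landed H_rad, H_hov, H_thin): a rev-2
final era with (NDF), (NL), (F), (F₀) and dispersal settles in its rest frames in the Statement's shape,
`∃ T₁ ρ R U₁ Φ₀, IsRestFrameSettledOn N M a T₁ ξ B Ψ O U₁ Φ₀ ρ R`. Construction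
(`Lines/registered-dead-c6.md` §2): radii `R` from H_rad; levels `ρₘ ↑ ∞` (`ρₘ ≥ ρ₀, ϱ₀, ϱ(1/(m+1)), m`),
`R̄ₘ = C₂ρₘ + C₁`; step times `tₘ ↑ ∞` placed after the thresholds of (F3) at `1/(m+1)`, (X3) at `ρₘ`,
(X4b) at `(τ'ₘ, R̄ₘ)` where `τ'ₘ` exceeds the H_rad `1/20`-threshold at `R̄ₘ`, the (F)-threshold at `R̄ₘ`,
the (NL)-threshold `T₄(i, R̄ₘ)` and the time after which `Rᵢ ≥ R̄ₘ`, and `tₘ ≥ m ρₘ`; `T₁ = t₀`;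
`U₁ = U₀ ⊓ ⋃ₘ {tₘ < y⁰ < tₘ₊₂ ∧ ∀ i, ρₘ < distᵢ}`; `Φ₀ = Ψ₀|U₁` (H_thin). Clauses: (C0)/(C1) H_thin;
(S1) `ρ(t)/t ≤ 1/m`; (S2) by the cover; (S3)/(S7) from (F3)/(F₀) since a `U₁`-point of time in
`[tₘ, tₘ₊₁)` is `ρₘ₋₁`-far; (S4)/(S5) H_rad; (O1) and (S6) by the case analysis: a point of `O` off
`certifiedLate` is either package-non-exempt — then (EX) at the same level and every flat-slab band point
`b` is, by (X3), (X4b), (NL), a hole-chart point of hole time `≤ τ₁` at radius `∈ [100Mᵢ, R̄ₘ]`, hovering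
(H_hov) to the `d`-slab — or a flat-late band point, which by (X3), (X4b) is a hole-chart point that is
either hole-late (then certified) or hovers to the `d`-slab (H_hov; (NDF) gives the radius floor).
Sources: DafermosLuk2017 (Conj. 1); ONeill1983 Ch. 14 (Cor. 14.1, push-up `I⁻J⁻ = I⁻`). Size: XL. -/
theorem stub_settledOfNormalised : open scoped Manifold Topology in ∀ (X : Type) [TopologicalSpace X] [ChartedSpace (EuclideanSpace ℝ (Fin 3)) X] [IsManifold (𝓡 3) ((⊤ : ℕ∞) : WithTop ℕ∞) X] [T2Space X] [SecondCountableTopology X] [ConnectedSpace X], ∀ (D : Literature.Geometry.Lorentzian.InitialDataSet (𝓡 3) X) (𝒟 : Literature.Geometry.Lorentzian.VacuumCauchyDevelopment D) (N : ℕ) (M a : Fin N → ℝ) (T δ V C₁ C₂ ρ₀ κ : ℝ) (ξ : Fin N → ℝ → EuclideanSpace ℝ (Fin 3)) (β : ℝ → ℝ) (U₀ : TopologicalSpace.Opens Literature.Geometry.Lorentzian.E4) (B₀ : Literature.Geometry.Lorentzian.ModelBackground) (B : Fin N → Literature.Geometry.Lorentzian.ModelBackground) (Ψ₀ : B₀.domain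 → 𝒟.carrier) (Ψ : (i : Fin N) → (B i).domain → 𝒟.carrier) (O : Set 𝒟.carrier), 𝒟.toCauchyDevelopment.IsFinalEra₂ N M a T δ V C₁ C₂ ρ₀ κ ξ β U₀ B₀ B Ψ₀ Ψ O → (∀ i (x : (B i).domain) (y : B₀.domain), T < x.1 0 → Ψ i x = Ψ₀ y → 100 * M i ≤ (B i).radius x.1) → (∀ i (R' : ℝ), ∃ T₄ : ℝ, ∀ (x : (B i).domain) (y : B₀.domain), T₄ ≤ x.1 0 → (B i).radius x.1 ≤ R' → Ψ i x = Ψ₀ y → x.1 0 ≤ y.1 0) → (∀ i (ρ : ℝ), ∀ᶠ τ in Filter.atTop, ∀ x ∈ (B i).truncTimeSlab ρ τ, 𝒟.toSpacetime.timeOrientation.IsFutureDirected (mfderiv 𝓘(ℝ, Literature.Geometry.Lorentzian.E4) (𝓡 4) (Ψ i) x (Literature.Geometry.Lorentzian.Kerr.timeVector (M i) (a i) x.1))) → (∃ ϱ₀ : ℝ, ∀ᶠ τ in Filter.atTop, ∀ x ∈ B₀.timeSlab τ, (∀ i, ϱ₀ ≤ ‖Literature.Geometry.Lorentzian.E4.spatial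 x.1 - ξ i τ‖) → 𝒟.toSpacetime.timeOrientation.IsFutureDirected (mfderiv 𝓘(ℝ, Literature.Geometry.Lorentzian.E4) (𝓡 4) Ψ₀ x (Literature.Geometry.Lorentzian.E4.basisVector 0))) → (∀ i j, i ≠ j → Filter.Tendsto (fun t ↦ ‖ξ i t - ξ j t‖) Filter.atTop Filter.atTop) → ∃ (T₁ : ℝ) (ρ : ℝ → ℝ) (R : Fin N → ℝ → ℝ) (U₁ : TopologicalSpace.Opens Literature.Geometry.Lorentzian.E4) (Φ₀ : (Literature.Geometry.Lorentzian.Minkowski.backgroundOn U₁).domain → 𝒟.carrier), 𝒟.toCauchyDevelopment.IsRestFrameSettledOn N M a T₁ ξ B Ψ O U₁ Φ₀ ρ R := by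
  sorry

/-! ## Composition: the crux BY NAME from the stubs (real proof; A, B₀ and C′ are the landed theorems) -/

/-- **DispersingCapture from the six stubs** (with the LANDED B₀ `stub_captureNoHoles` and C′
`stub_captureOfSettledOn` imported): at the crux's binders, split on the number of labels. `N = 0`: B₀
consumes the package, (R) and (F₀) directly. `N = n + 1`: E supplies the integrable escape rates; B₁ₐ the
two chart normalisations; H_core the rest-frame settled charts `IsRestFrameSettledOn …`; C′ captures. -/
theorem DispersingCapture_of :
    Sig.stub_escapeRate → Sig.stub_normalisedOverlap → Sig.stub_settledOfNormalised → DispersingCapture := by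
  intro hE hB₁ₐ hCore X _ _ _ _ _ _ D hD 𝒟 hmax hscri N
  cases N with
  | zero =>
    intro M a T δ V C₁ C₂ ρ₀ κ ξ β U₀ B₀ B Ψ₀ Ψ O hera hrays _hholes hflat _hdisp
    exact stub_captureNoHoles X D 𝒟 M a T δ V C₁ C₂ ρ₀ κ ξ β U₀ B₀ B Ψ₀ Ψ O hera hrays hflat
  | succ n =>
    intro M a T δ V C₁ C₂ ρ₀ κ ξ β U₀ B₀ B Ψ₀ Ψ O hera hrays hholes hflat hdisp
    -- (E): the GR input — integrable pairwise escape rates of the dispersing era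
    have hesc : ∀ i j, i ≠ j → IntegrableOn (fun t ↦ 1 / ‖ξ i t - ξ j t‖ ^ 2) (Ici T) :=
      hE X D hD 𝒟 hmax hscri (n + 1) M a T δ V C₁ C₂ ρ₀ κ ξ β U₀ B₀ B Ψ₀ Ψ O hera hrays hholes hflat
        hdisp
    -- (B₁ₐ): the two chart normalisations (residual restatement target)
    obtain ⟨hndf, hnl⟩ :=
      hB₁ₐ X D hD 𝒟 hmax hscri (n + 1) M a T δ V C₁ C₂ ρ₀ κ ξ β U₀ B₀ B Ψ₀ Ψ O hera hrays hholes hflat hdisp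
    -- (H_core, the bridge): rest-frame Statement-shaped settled charts
    obtain ⟨T₁, ρ, R, U₁, Φ₀, hset⟩ :=
      hCore X D 𝒟 (n + 1) M a T δ V C₁ C₂ ρ₀ κ ξ β U₀ B₀ B Ψ₀ Ψ O hera hndf hnl hholes hflat hdisp
    -- (C′, landed): capture of the settled, dispersing era
    exact stub_captureOfSettledOn X D 𝒟 (n + 1) M a T δ V C₁ C₂ ρ₀ κ ξ β U₀ B₀ B Ψ₀ Ψ O T₁ ρ R U₁ Φ₀ hera
      hset hrays hholes hdisp hesc

/-- The crux by name, closed modulo the registered stubs (A, B₀, B_sep, B₂a, B₂b, C, C′ landed). -/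
theorem dispersingCapture_of_stubs : DispersingCapture :=
  DispersingCapture_of stub_escapeRate stub_normalisedOverlap stub_settledOfNormalised

end Summit.FinalStateConjecture.FinalStateConjecture.Cruxes.DispersingCapture.Birth

end
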